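import Mathlib
import HarnessLib
import Summits.HubbardSuperconductivity.HubbardSuperconductivity.Theorems.WeakCouplingBCSKlCertB1gWindowD005D030
import Summits.HubbardSuperconductivity.HubbardSuperconductivity.Theorems.WeakCouplingBCSDefsKlCertB1gWinU1Record
import Summits.HubbardSuperconductivity.HubbardSuperconductivity.Theorems.WeakCouplingBCSDefsKlCertB1gWinU2Record
import Summits.HubbardSuperconductivity.HubbardSuperconductivity.Theorems.WeakCouplingBCSDefsKlCertB1gWinU3Record
import Summits.HubbardSuperconductivity.HubbardSuperconductivity.Theorems.WeakCouplingBCSDefsKlCertB1gWinVRecord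
import Summits.HubbardSuperconductivity.HubbardSuperconductivity.Theorems.WeakCouplingBCSDefsKlCertB1gWinWRecord

/-!
# Route `WeakCouplingBCS` — support item `WcbcsKohnLuttingerB1g` (stmt-HubbardSuperconductivity-0158):
# `B1g` dominance on the STRETCHED chemical-potential window `μ ∈ [-0.8925, -0.075]` (hole dopings `δ ∈ [0.05, 0.35]`)

The stretch records `klCertB1gWinU1` (24 boxes on `[-0.8925, -0.8625]`, `γ = 10371 / 1048576`), `klCertB1gWinU2` (24 boxes on
`[-0.8625, -0.8325]`, `γ = 15273 / 1048576`), `klCertB1gWinU3` (24 boxes on `[-0.8325, -0.8025]`, `γ = 20511 / 1048576`),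
`klCertB1gWinV` (15 boxes on `[-0.8025, -0.765]`, `γ = 14881 / 1048576`), `klCertB1gWinW` (15 boxes on `[-0.765, -0.7275]`, `γ =
18675 / 1048576`) of the cell `gate-hubbard-kl` (seats hubbard-kl-cert-2 g4 + hubbard-kl-cert-3 g4/g5, STRETCH-D035 form (i); 102
contiguous
μ-uniform boxes on `μ ∈ [-0.8925, -0.7275]`, i.e. `δ ≈ 0.30–0.35`: quarter-width boxes (`1/800`) at `N = 416` on `[-0.8925, -0.8025]`,
half-width boxes (`1/400`) at `N = 320 / 256` on `[-0.8025, -0.7275]`) are adjacent to each other and to the glued window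
`klb1g_window_d005_d030` (`[-0.7275, -0.075]`, records `klCertB1gWin{X,Y,Z,A,B,C,D}`, 148 boxes).  Each record is accepted by the
multiplicity-aware checker (`decide +kernel` in its own file) and certifies, modulo its named enclosures, μ-uniform `B1g` dominance on
its window (`klb1gd_window_U`).  Gluing (`klb1gd_dominance_union`) gives `klb1g_window_d030_d035` on `[-0.8925, -0.7275]` and
`klb1g_window_d005_d035` on the union `[-0.8925, -0.075]` — an interval containing the free-band chemical potentials of ALL hole dopings
`δ ∈ [0.05, 0.35]` (certified monotone Riemann brackets of `δ(μ) = 1 - (2/π²)∫₀^π arccos⋆(-μ/2 - cos x) dx`: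
`δ(-0.8925) ∈ [0.352281, 0.352282]`, `δ(-0.075) ∈ [0.048352, 0.048354]`; the δ-reading of the new end in the tree is
`muWinD035_filling_lt : n(-0.8925) < 13/20`, `Theorems/KLProgrammeMuOfDopingWindowFillingD035Upper.lean`; write-up
HOME/hubbard-kl-cert-2/MU-WINDOW-4.md (tables: HOME/hubbard-kl-cert-3/STRETCH-TABLE-g5.md)) — for every `0 < U < 1` and every
channel `χ ≠ B1g`:
`channelInf ε₀ μ U B1g + γ U² ≤ channelInf ε₀ μ U χ` with `γ` the minimum of the twelve record margins (`= 10371 / 1048576`,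
`klb1g_window_d005_d035_gamma_eq`).  The hypotheses are the twelve named numerical statements `klCertB1gWin_.EnclosuresB1g`
(250 boxes × (E1, E2, 4 × E4) inequalities, each μ-uniform on its box), certified outside Lean by interval arithmetic in two independent
implementations (gate cell `gate-hubbard-kl`, HOME/MU-WINDOW.md, HOME/hubbard-kl-cert-2/MU-WINDOW-2.md, -3.md, -4.md; kit jobs
j272077 j272078 j272079 j272081 (cert-2 g4) j275695 j275696 j275697 j275698 j275701 j281058 j281059 j281060 (cert-3 g4)).
-/

noncomputable section

-- the tree's namespace `Summit.<Summit>.<Problem>.Theorems` repeats the summit name by design (D-0017)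
set_option linter.dupNamespace false

namespace Summit.HubbardSuperconductivity.HubbardSuperconductivity.Theorems

open Literature.MathematicalPhysics.QuantumLattice CwKLChiralWindow
open Summit.HubbardSuperconductivity.HubbardSuperconductivity.Theses.WeakCouplingBCS

/-- **`B1g` dominance on the stretch window `μ ∈ [-0.8925, -0.7275]`** (`δ ≈ 0.30–0.35`), modulo the certified enclosures of the
5 stretch records: for every such `μ`, every `0 < U < 1` and every `χ ≠ B1g`,
`channelInf ε₀ μ U B1g + γ·U² ≤ channelInf ε₀ μ U χ` with `γ` the minimum of the 5 record margins. [cite: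
RaghuKivelsonScalapino2010, §III Fig. 2] -/
theorem klb1g_window_d030_d035 (hU1 : klCertB1gWinU1.EnclosuresB1g) (hU2 : klCertB1gWinU2.EnclosuresB1g)
    (hU3 : klCertB1gWinU3.EnclosuresB1g) (hV : klCertB1gWinV.EnclosuresB1g) (hW : klCertB1gWinW.EnclosuresB1g) :
    ∀ μ ∈ Set.Icc (-0.8925 : ℝ) (-0.7275), ∀ U ∈ Set.Ioo (0 : ℝ) 1, ∀ χ : D4Irrep, χ ≠ D4Irrep.B1g →
      channelInf (squareDispersion 1 0) μ U D4Irrep.B1g +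
          min ((klCertB1gWinU1.gamma : ℚ) : ℝ) (min ((klCertB1gWinU2.gamma : ℚ) : ℝ) (min ((klCertB1gWinU3.gamma : ℚ) : ℝ) (min ((klCertB1gWinV.gamma : ℚ) : ℝ) ((klCertB1gWinW.gamma : ℚ) : ℝ)))) * U ^ 2 ≤
        channelInf (squareDispersion 1 0) μ U χ := by
  have wU1 := klCertB1gWinU1_window_U hU1
  have wU2 := klCertB1gWinU2_window_U hU2
  have wU3 := klCertB1gWinU3_window_U hU3
  have wV := klCertB1gWinV_window_U hV
  have wW := klCertB1gWinW_window_U hW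
  have loU1 : (((klCertB1gWinU1).mub : ℚ) : ℝ) = -0.8925 := by
    show ((((-357 : ℚ) / 400) : ℚ) : ℝ) = -0.8925
    norm_num
  have hiU1 : (((klCertB1gWinU1).mua : ℚ) : ℝ) = -0.8625 := by
    show ((((-69 : ℚ) / 80) : ℚ) : ℝ) = -0.8625
    norm_num
  rw [loU1, hiU1] at wU1
  have loU2 : (((klCertB1gWinU2).mub : ℚ) : ℝ) = -0.8625 := by
    show ((((-69 : ℚ) / 80) : ℚ) : ℝ) = -0.8625
    norm_num
  have hiU2 : (((klCertB1gWinU2).mua : ℚ) : ℝ) = -0.8325 := by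
    show ((((-333 : ℚ) / 400) : ℚ) : ℝ) = -0.8325
    norm_num
  rw [loU2, hiU2] at wU2
  have loU3 : (((klCertB1gWinU3).mub : ℚ) : ℝ) = -0.8325 := by
    show ((((-333 : ℚ) / 400) : ℚ) : ℝ) = -0.8325
    norm_num
  have hiU3 : (((klCertB1gWinU3).mua : ℚ) : ℝ) = -0.8025 := by
    show ((((-321 : ℚ) / 400) : ℚ) : ℝ) = -0.8025
    norm_num
  rw [loU3, hiU3] at wU3
  have loV : (((klCertB1gWinV).mub : ℚ) : ℝ) = -0.8025 := by
    show ((((-321 : ℚ) / 400) : ℚ) : ℝ) = -0.8025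
    norm_num
  have hiV : (((klCertB1gWinV).mua : ℚ) : ℝ) = -0.765 := by
    show ((((-153 : ℚ) / 200) : ℚ) : ℝ) = -0.765
    norm_num
  rw [loV, hiV] at wV
  have loW : (((klCertB1gWinW).mub : ℚ) : ℝ) = -0.765 := by
    show ((((-153 : ℚ) / 200) : ℚ) : ℝ) = -0.765
    norm_num
  have hiW : (((klCertB1gWinW).mua : ℚ) : ℝ) = -0.7275 := by
    show ((((-291 : ℚ) / 400) : ℚ) : ℝ) = -0.7275
    norm_num
  rw [loW, hiW] at wW
  have u1 := klb1gd_dominance_union (a₁ := (-0.8025 : ℝ)) (b₁ := (-0.765 : ℝ)) (a₂ := (-0.765 : ℝ)) (b₂ := (-0.7275 : ℝ))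
    le_rfl wV wW
  have u2 := klb1gd_dominance_union (a₁ := (-0.8325 : ℝ)) (b₁ := (-0.8025 : ℝ)) (a₂ := (-0.8025 : ℝ)) (b₂ := (-0.7275 : ℝ))
    le_rfl wU3 u1
  have u3 := klb1gd_dominance_union (a₁ := (-0.8625 : ℝ)) (b₁ := (-0.8325 : ℝ)) (a₂ := (-0.8325 : ℝ)) (b₂ := (-0.7275 : ℝ))
    le_rfl wU2 u2
  have u4 := klb1gd_dominance_union (a₁ := (-0.8925 : ℝ)) (b₁ := (-0.8625 : ℝ)) (a₂ := (-0.8625 : ℝ)) (b₂ := (-0.7275 : ℝ))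
    le_rfl wU1 u3
  exact u4

/-- **`B1g` (`d_{x²-y²}`) dominance of the second-order Kohn–Luttinger vertex on the stretched window `μ ∈ [-0.8925, -0.075]`**
(⊃ `μ([0.05, 0.35])`), modulo the certified enclosures of the twelve window records: for every such `μ`, every `0 < U < 1` and
every `χ ≠ B1g`, `channelInf ε₀ μ U B1g + γ·U² ≤ channelInf ε₀ μ U χ` with `γ = min γ_stretch γ_030` (the record margins).
[cite: RaghuKivelsonScalapino2010, §III Fig. 2] -/
theorem klb1g_window_d005_d035 (hU1 : klCertB1gWinU1.EnclosuresB1g) (hU2 : klCertB1gWinU2.EnclosuresB1g)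
    (hU3 : klCertB1gWinU3.EnclosuresB1g) (hV : klCertB1gWinV.EnclosuresB1g) (hW : klCertB1gWinW.EnclosuresB1g)
    (hX : klCertB1gWinX.EnclosuresB1g) (hY : klCertB1gWinY.EnclosuresB1g)
    (hZ : klCertB1gWinZ.EnclosuresB1g) (hA : klCertB1gWinA.EnclosuresB1g) (hB : klCertB1gWinB.EnclosuresB1g)
    (hC : klCertB1gWinC.EnclosuresB1g) (hD : klCertB1gWinD.EnclosuresB1g) :
    ∀ μ ∈ Set.Icc (-0.8925 : ℝ) (-0.075), ∀ U ∈ Set.Ioo (0 : ℝ) 1, ∀ χ : D4Irrep, χ ≠ D4Irrep.B1g →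
      channelInf (squareDispersion 1 0) μ U D4Irrep.B1g +
          min (min ((klCertB1gWinU1.gamma : ℚ) : ℝ) (min ((klCertB1gWinU2.gamma : ℚ) : ℝ) (min ((klCertB1gWinU3.gamma : ℚ) : ℝ) (min ((klCertB1gWinV.gamma : ℚ) : ℝ) ((klCertB1gWinW.gamma : ℚ) : ℝ)))))
            (min ((klCertB1gWinX.gamma : ℚ) : ℝ)
            (min ((klCertB1gWinY.gamma : ℚ) : ℝ)
              (min (min ((klCertB1gWinZ.gamma : ℚ) : ℝ)
                (min (min ((klCertB1gWinA.gamma : ℚ) : ℝ) ((klCertB1gWinB.gamma : ℚ) : ℝ)) ((klCertB1gWinC.gamma : ℚ) : ℝ)))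
                ((klCertB1gWinD.gamma : ℚ) : ℝ)))) * U ^ 2 ≤
        channelInf (squareDispersion 1 0) μ U χ :=
  klb1gd_dominance_union (a₁ := (-0.8925 : ℝ)) (b₁ := (-0.7275 : ℝ)) (a₂ := (-0.7275 : ℝ)) (b₂ := (-0.075 : ℝ))
    le_rfl (klb1g_window_d030_d035 hU1 hU2 hU3 hV hW) (klb1g_window_d005_d030 hX hY hZ hA hB hC hD)

/-- The stretch margin is positive: `min` of the 5 stretch record margins `> 0` (kernel decision). [folklore] -/
theorem klb1g_window_d030_d035_gamma_pos : 0 < min klCertB1gWinU1.gamma (min klCertB1gWinU2.gamma (min klCertB1gWinU3.gamma (min klCertB1gWinV.gamma klCertB1gWinW.gamma))) := by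
  decide +kernel

/-- The numerical value of the stretch margin: `10371 / 1048576 ≈ 0.009891`. [folklore] -/
theorem klb1g_window_d030_d035_gamma_eq : min klCertB1gWinU1.gamma (min klCertB1gWinU2.gamma (min klCertB1gWinU3.gamma (min klCertB1gWinV.gamma klCertB1gWinW.gamma))) = 10371 / 1048576 := by
  decide +kernel

/-- The stretched-window margin is positive (kernel decision on the twelve record rationals). [folklore] -/
theorem klb1g_window_d005_d035_gamma_pos :
    0 < min (min klCertB1gWinU1.gamma (min klCertB1gWinU2.gamma (min klCertB1gWinU3.gamma (min klCertB1gWinV.gamma klCertB1gWinW.gamma))))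
      (min klCertB1gWinX.gamma
      (min klCertB1gWinY.gamma
        (min (min klCertB1gWinZ.gamma (min (min klCertB1gWinA.gamma klCertB1gWinB.gamma) klCertB1gWinC.gamma))
          klCertB1gWinD.gamma))) := by
  decide +kernel

/-- The numerical value of the stretched-window margin: `γ = 10371 / 1048576 ≈ 0.009891` (the minimum of the twelve record
margins). [folklore] -/
theorem klb1g_window_d005_d035_gamma_eq :
    min (min klCertB1gWinU1.gamma (min klCertB1gWinU2.gamma (min klCertB1gWinU3.gamma (min klCertB1gWinV.gamma klCertB1gWinW.gamma))))
      (min klCertB1gWinX.gamma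
      (min klCertB1gWinY.gamma
        (min (min klCertB1gWinZ.gamma (min (min klCertB1gWinA.gamma klCertB1gWinB.gamma) klCertB1gWinC.gamma))
          klCertB1gWinD.gamma))) = 10371 / 1048576 := by
  decide +kernel

end Summit.HubbardSuperconductivity.HubbardSuperconductivity.Theorems

end
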